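import Mathlib
import HarnessLib
import HarnessLib.Audit
import Summits.QuantumFields.Statement
import Summits.QuantumFields.YangMills.Theses.UnitScaleTilt
import Summits.QuantumFields.YangMills.Theses.FibreConvexityTail
import Summits.QuantumFields.YangMills.Theorems.FibreConvexityTailHistoryTailOfTwoSided
import Literature.MathematicalPhysics.QuantumFieldTheory.Balaban1983to89.T3YM3TorusStatement
import HarnessLib.Audit.Status.Attr

/-!
Route: MultiscaleHerbst

# Route MultiscaleHerbst — multiscale Herbst — two-scale log-Sobolev induction over Bałaban's
fluctuation scales with a Ward-protected coarse-grained stiffness gives the two-sided window tail of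
rung R3

LINE 10 (D-0145 ideator seat ym-r3-idea-2 g5, lens «nearmiss»; bears_on LADDER-YM rung R3 = leaf
`T3YM3TorusStatement.YM3TorusSU2` via
crux stmt-QuantumFields-19936 `UnitScaleTilt.HistoryTailL`; NO summit and no Clay statement is
proved by this line, and the rung itself
stays open behind the residual cruxes). It suffices to show X = WindowHerbstCapL (rev 2: the
weakest-sufficient form; the rev-0 X = WindowHerbstL with the entropy clause for every t ≥ 0 is kept
ASIDE and implies it): for every level-j plaquette a (1 ≤ j, j+2 ≤ K) there is a
measurable W ⊇ {every finer level i < j Bałaban-small} ∩ {the conditioner Ū^(j+2) Bałaban-small} on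
which, under Gibbs_K restricted to
W, the normalised deviation f = |Ū^j(∂a) − 1|/g_(K−j) is CENTRED below a quarter of Bałaban's
exponent (∫_W f ≤ (p(g_(K−j))/4)·Gibbs_K(W))
and satisfies the HERBST ENTROPY BOUND Ent_W(e^(tf)) ≤ (σ²t²/2)·∫_W e^(tf) for every t in the
Chernoff range 0 ≤ t ≤ p(g_(K−j)), with ONE σ
uniform in K, j, a (content: σ = O(1), against the free Hoeffding constant σ_free ≈ 75L^(5/2)·p,
which gives no decay). Herbst's
argument on [0, p] + Markov turn X into FibreConvexityTail's `TwoSidedTailL` (support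
TwoSidedOfWindowHerbstCap); the landed glue of that route and
the shared residual `TowerTailL` give HistoryTailL; the parent's two residual cruxes give the leaf
by `UnitScaleTilt.closes`.
Lean: `Summit.QuantumFields.YangMills.Theses.MultiscaleHerbst.WindowHerbstCapL`

## Assembly
`closes` (glue.lean rev 2, kernel-checked in Sketch10b.lean as `assembly_cap`, sorry-free, one
term): `UnitScaleTilt.closes h200 h201
(fibreConvexityTail_historyTailOfTwoSided_proof (hGc hXc) hT)` — the parent route's deciding theorem
applied to its two residual cruxes
(byte-identical restatements, shared items 19200/20520), with `HistoryTailL` obtained from the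
LANDED glue of route FibreConvexityTail
(item 25569, p609164) fed with `TwoSidedTailL := TwoSidedOfWindowHerbstCap WindowHerbstCapL` (items
28310, 28309) and the shared residual `TowerTailL` (25568).
Every binder is consumed; WindowHerbstCapL is load-bearing (TwoSidedTailL is NOT an item of this
route); the aside WindowHerbstL (28165) and the
proved rev-0 support TwoSidedOfWindowHerbst (28166, p643113) are context.

CLOSES_TARGET: closes rung R3 of QuantumFields: Literature.MathematicalPhysics.QuantumFieldTheory.Balaban1983to89.T3YM3TorusStatement.YM3TorusSU2 (D-0061; not the summit Statement) — the deciding theorem of this route concludes that registered leaf instead of the Statement decl `YangMills` (class rung: servable and labelled, never counted as concluding the summit Statement).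

Rationale: WHY THIS LINE. NEAR-MISS HARVESTED (the seat's own corpse, measured): route FibreConvexityTail's
birth line (deep-fibre log-concavity + Herbst) died on
the instrument row JOB B — the smallest horizontal Hessian eigenvalue of β_K·S on the fibre obeys
the collapse law κ₀(s) ≈ 4^(−s)β_K·Φ(ε₀L^s),
Φ(0) = 8.64, Φ(x) ≈ 8.64 − 0.2x − 0.45x², zero at x ≈ 2 (x = finest-scale in-window roughness ×
L^(fluctuation scale)): bare convexity of
the scale-s modes survives exactly while θ(K)·L^s ≲ 2, i.e. for s ≲ K/2 — the measured deficit is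
the linear (one-loop) + logarithmic
(two-loop) UV self-energy of the soft modes in d = 3 (the Nielsen–Olesen/Savvidy mechanism: fine
roughness destabilises coarse modes, never
the converse). The SINGLE INPUT TO IMPROVE is therefore named: replace the bare block Hessian by the
COARSE-GRAINED stiffness Hess H̄_s =
⟨Hess S⟩ − Cov(∇_s S | finer scales) (exact identity), bound Cov by Brascamp–Lieb from the finer
scales' own convexity (induction upward from
the finest scale, whose conditional law given everything coarser IS convex), and evaluate the one-
and two-loop parts explicitly: their
k⁰ pieces cancel by the exact lattice Ward identity of Bałaban's covariant averaging (H̄_s is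
gauge-invariant), the rest decays by
Helffer–Sjöstrand. With the protected stiffness ρ_s ≍ β_K L^(−s) per unit block variable, the
two-scale criterion of
Grunewald–Otto–Villani–Westdickenberg / Otto–Reznikoff (doi:10.1214/07-aihp200 Thm 3 p.307;
paper:doi-10-1016-j-jfa-2006-10-002 Thm 2 p.128 = the two-scale criterion, Thm 1 p.123 = the N-site
assembly across the O(1) fluctuation scales; Menz
arXiv:1309.0862) assembles a log-Sobolev inequality in the weighted carré du champ Σ_s ρ_s⁻¹|∇_s·|²,
in which the plaquette observable has
Σ_s ρ_s⁻¹|∇_s f|² = O(1) uniformly in K and j (β_K g_(K−j)² = L^j exactly balances |∇_s f|² ≍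
L^(−j)·L^(−4(s−j))); Herbst's argument
(Bakry–Gentil–Ledoux book:bakry2013 Prop 5.4.1 p.252, IN TREE as
`Literature.Probability.Moments.HerbstArgument`; Guionnet 2009 §4) is then the typed crux verbatim —
in its WEAKEST-SUFFICIENT form WindowHerbstCapL (entropy clause only on the Chernoff range 0 ≤ t ≤
p; amendment rev 1 after critic verdict #112). Imported from: functional inequalities /
hydrodynamic limits (two-scale LSI), constructive RG (Bałaban's averaging and Ward identities,
Balaban1985UV3, Balaban1984PropagatorsI),
stochastic quantisation of lattice YM (Bakry–Émery on SU(N)^E: Shen–Zhu–Zhu arXiv:2204.12737 Thm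
1.2/Lemma 4.4, strong coupling only —
this line is its multiscale weak-coupling counterpart on a window). What no listed route does: L1
CoarseStiffnessTail asks for a capped
exponential-moment free energy, L2 for log-concavity of the deep fibre (dead), L7/L8/L9 re-currency
the tail (Orlicz / window-MGF / wedge);
none names a mechanism that survives the K/2 threshold — this line's lever is the scale-INDUCTIVE
LSI whose only non-perturbative input is a
positive coarse-grained stiffness, i.e. exactly the quantity JOB B says the bare theory lacks and
perturbation theory says the dressed theory has.

RANKED CRUXES. #2 WindowHerbstCapL (crux, stmt-QuantumFields-28309) — CAPPED WINDOW HERBST BOUND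
(weakest-sufficient form; rev 1) — ∀ L ∃ bmin ∀ b₀ ≥ bmin (0 < b₀), p₀ > 2 ∃ 0 < γ₁ ≤ 1 ∀ F (F.L =
L), 0 < γ ≤ γ₁ ∃ σ > 0 ∀ K, 1 ≤ j, j+2 ≤ K, ∀ level-j plaquette a ∃ measurable W ⊇ {∀ i < j,
PlaqSmall θBal(K−i) (Ū^i)} ∩ {PlaqSmall θBal(K−j−2) (Ū^(j+2))}: (centring) ∫_W f dGibbs_K ≤
(p(g_(K−j))/4)·Gibbs_K(W) and (entropy, ONLY for 0 ≤ t ≤ p(g_(K−j))) ∫_W e^(tf)·tf − (∫_W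
e^(tf))·log((∫_W e^(tf))/Gibbs_K(W)) ≤ (σ²t²/2)·∫_W e^(tf), f = dist1(Ū^j(∂a))/√(γL^(−(K−j))), p =
B10.pFun b₀ p₀ (junk-safe at Gibbs_K(W) = 0; f bounded). WHAT IS FREE AND WHAT IS CONTENT (critic
#112): for ANY bounded f and ANY law Ent(e^(tf)) ≤ (osc f)²t²/8·∫e^(tf) (Hoeffding); on the
conditioning event f ≤ 151L^(5/2)·p(g_(K−j+1)) deterministically (level j−1 constrained, one-step
transport), so σ_free ≈ 75L^(5/2)·p and Chernoff with it gives exp(−O(L^(−5))) — no decay; the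
ENTIRE content is σ = O(1) uniformly in (K, j, a), i.e. beating the Hoeffding constant by the factor
p(g)², a log-Sobolev-strength statement for one observable under the window-restricted law. The cap
t ≤ p is exactly the Chernoff range (t* = min(p, 3p/(4σ²))); beyond t ≈ C_L·p the tilted law is
squeezed against the deterministic ceiling of f on W and the entropy grows like (dof)·log t, so the
uncapped ∀ t ≥ 0 clause of the rev-0 crux WindowHerbstL was SURPLUS strength (possibly false at
astronomically large t) — WindowHerbstL (stmt-QuantumFields-28165) is therefore re-badged ASIDE:
kept in the file (the landed p643113 and the 19936 skeleton cite it; it implies WindowHerbstCapL by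
dropping the cap, `windowHerbstCapL_of_windowHerbstL` in the line skeleton), never staffed.
[difficulty: XL] (why it might fail: σ K,j-uniform on the Chernoff range: beyond s ≈ K/2 only the
Ward-dressed stiffness ⟨Hess⟩ − Cov is positive, known only perturbatively ([Balaban1985UV3]
(70)–(71) p.273, [Balaban1985Variational] Thm 1 p.279, CMP 122-II p.380); JOB B: the bare stiffness
changes sign there; W non-convex (leak at ∂W).) [paper:doi-10-1016-j-jfa-2006-10-002 Thm 2 p.128,
doi:10.1214/07-aihp200 Thm 3 p.307, book:bakry2013-analysis-geometry-markov-diffusion-operators Prop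
5.4.1 p.252 / 5.7.1 p.268, arXiv:1907.12308, arXiv:2202.02295 Thm 1.1, arXiv:1309.0862,
arXiv:2204.12737, Balaban1985UV3, Balaban1985Variational, Balaban1984PropagatorsI]
#3 TowerTailL (crux) — TOWER TAIL (residual, shared item stmt-QuantumFields-25568 of route
FibreConvexityTail, restated byte-identically): the finest-bad-level tail with the conditioner
Ū^(j+2) LARGE somewhere, ≤ C·β_(K−j)^A·exp(−c·p(g_(K−j))²). HONEST PLACEMENT: a sub-event of the
plain per-plaquette tail two heights up, hence organ-class (implied by the organ at height K−j−2);
this line does not touch it — its content is the conditioned half for ALL heights, where L2 reached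
only the deep half and died. [difficulty: open-problem] (why it might fail: Organ-class residual:
conditioner chains with inflated thresholds fail marginally (threshold growth L³/2 per two levels is
matched one-for-one by the deterministic transport loss of the window), so no bootstrap from
WindowHerbstL is offered.) [Balaban1985UV3, Balaban1989LargeFieldII]
#4 FluctuationComparisonRegPrIntL (crux) — residual crux of the parent route
(stmt-QuantumFields-20520, K1b-INT), restated byte-identically; not touched by this line.
[difficulty: open-problem] (why it might fail: Cross-cut-off content UNPRINTED for non-abelian d=3:
the King-slack two-run row at every co-height must come from the (α) record; excision removes only
the window's EDGE clause.) [Balaban1985UV3, King1986, Balaban1988Convergent]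
#5 MinimiserStabilityRegPr (crux) — residual crux of the parent route (stmt-QuantumFields-19200,
K1aR-pr), restated byte-identically; not touched by this line. [difficulty: open-problem] (why it
might fail: Printed only as Bałaban's variational-problem stability for small data; the L-uniform
quadratic remainder at every co-height is the unprinted part.) [Balaban1985Variational,
Balaban1985UV3]
#9 TwoSidedOfWindowHerbstCap (support, stmt-QuantumFields-28310) — HERBST ON [0, p] + CHERNOFF
(provable now, S): WindowHerbstCapL → FibreConvexityTail.TwoSidedTailL. Adapt the landed p643113
(`Theorems/MultiscaleHerbstTwoSidedOfWindowHerbst.lean`): `herbst_mgf_le` with the entropy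
hypothesis on [0, T], T = p (φ′ ≤ 0 is local in t), then Chernoff on W ∩ {p ≤ f} ⊇ twoSidedEvent at
t = min(p, 3p/(4σ²)) (or replace σ by max σ 1): C = 1, A = 0, c = min(1/4, 9/(32σ²)); bmin, γ₁ pass
through. In-tree: `Literature.Probability.Moments.HerbstArgument` ([BakryGentilLedoux2014 Prop
5.4.1]), `FibreConvexityTail.stub_chernoffOnEvent`. [difficulty: provable-now] #9
TwoSidedOfWindowHerbst (support, stmt-QuantumFields-28166) — PROVED (p643113, ym-ust-19936-w2 g8,
14:58Z) for the rev-0 strong crux; context only after rev 1.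
[book:bakry2013-analysis-geometry-markov-diffusion-operators, arXiv:2204.12737]

TWO-LAYER PLAN. Foreseen glued split of WindowHerbstCapL by REGIME (registered as the BC3 birth
skeleton Lines/multiscale_herbst.lean, join proved):
DeepWindowHerbst (2j+2 ≤ K: every fluctuating scale s ≤ j+1 below K/2, bare nested-chart convexity —
JOB B's PASS regime) →
ShallowWindowHerbst (K < 2j+2: Ward-protected stiffness load-bearing) → WindowHerbstCapL (skeleton
v4, cap threaded through both halves). Inside each half the chain is (S1) nested
fluctuation chart with per-level block-axial gauge on the window, (S2) one-scale window convexity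
given a smoother background (Bałaban
propagator positivity), (S3) coarse-grained stiffness ≥ ½ρ_s [shallow half only], (S4) cross-scale
Brascamp–Lieb dominance Σ κ_ss'/√(ρ_sρ_s')
≤ 1/2, (S5) two-scale LSI ⇒ weighted LSI ⇒ Herbst entropy bound, (S6) centring E_W f ≤ p/4
(constrained minimiser + mean–mode gap; bmin
spent here). Nothing of this is filed as items now.

KILL CRITERIA. Refutation of WindowHerbstCapL (a K-growing lower bound on the window entropy of
e^(tf) for some t in the Chernoff range 0 ≤ t ≤ p, or E_W f ≥ p/2 at some height)
closes the route (close --reason refuted:WindowHerbstCapL); a refutation of the ASIDE WindowHerbstL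
at t ≫ p (Laplace squeeze against the ceiling of f on W) does NOT — it only confirms why the cap was
installed. INSTRUMENT BEFORE PROVERS (critic #112 price 4): the dressed-stiffness row below is to be
run before any prover is seated on 28309. The INSTRUMENT ROW that refutes the key lemma: extend JOB
B to the DRESSED
stiffness — κ_eff(s) := smallest eigenvalue of ⟨Hess_ss S⟩_W − Cov_W(∇_s S | scales < s) at s = jp2
= K (the KILL view), K = 3,4,5, ε₀ ∈
{0.1, 0.2, 0.4}: if κ_eff(K)·4^K/β_K stays ≤ 0 like the bare κ₀ (no Ward restoration visible),
ShallowWindowHerbst is dead and the line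
with it; if it is ≥ c > 0 K-independently the line's bet stands. A proof elsewhere of the
per-plaquette averaged tail (owner's organ,
22884-type items) moots the route (superseded). TowerTailL refuted ⇒ pivot to a top-conditioner
variant (condition on the finest free
level only; residual = one inflated-threshold tail at height K/m − 1).

NOT DECOMPOSED YET. The regime split (now of WindowHerbstCapL) and the six-step chain (S1)–(S6)
above; the chart/gauge-fixing lemma (F1) (per-level block-axial small-field gauge
|A| ≤ c₁Lθ, asked of the owner in g4); the convexification of the window (W ⊇ window is existential
in the crux for exactly this
reason); constants (σ(L, b₀, p₀, F, γ), bmin = 4·sup E_W f). All are layer-2 children after the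
tribunal.

CHEAPEST FALSIFIER. The dressed-stiffness row above at the smallest size (K = 3, jp2 = 3, ε₀ = 0.2,
L = 2 surrogate as in JOB B): one covariance matrix of
∇_K S under the window-restricted finer-scale law (Metropolis on the fibre, ~10⁴ sweeps) subtracted
from the JOB-B Hessian average. Not
run (kit 0 at this seat; B2 falsifiers go through the critic's engines) — filed as the instrument
request with the line. Second, free:
E_W f at height K−j = 1 from JOB A's table (f_(K−1)(K) = 0.027/0.021/0.016 for K = 2,3,4 ≪ p/4) —
consistent with centring.

NUMBERS. JOB B (seat instrument, 2026-08-28): κ₀(s = jp2 = 3, j = 1) = 8.31 / 7.33 / 3.42 / −12.2 /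
−75.0 at ε₀ = 0.05 / 0.1 / 0.2 / 0.4 / 0.8,
K-independent; KILL view jp2 = K: κ₀ < 0 from ε₀·2^K ≳ 2. JOB A: unit-observable drift f_(K−1)(K) =
0.0274, 0.0214, 0.0159 (K = 2,3,4).
JOB C row B (conditioning lever) c/u ∈ [0.90, 1.03] (KILL-lean) — why the conditioner is kept at j+2
and not used as a lever. Scale
bookkeeping: β_K = L^K/γ, g_h² = γL^(−h), θ(h) = g_h·p(g_h), p(g) = b₀(1 + log g⁻¹)^(p₀);
block-variable stiffness ρ_s ≍ β_K L^(−s)·4^(−s)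
(JOB B normalisation), |∇_s f|² ≍ L^(−j)·L^(−4(s−j))/g_h², so Σ_(s ≥ j) ρ_s⁻¹|∇_s f|² ≍
γL^(−K)·L^j·L^(K−j)/γ·Σ L^(−3(s−j)) = O(1).

DEFINITION REQUESTS. None new: the window, f, p, Gibbs_K, θBal, PlaqSmall, blockAvg are tree
declarations; the coarse-grained stiffness and the weighted carré
du champ live inside the proof (layer 2), not in the statement.

Novelty: Searches (2026-08-28): lit search --hybrid "two-scale logarithmic Sobolev inequality coarse-graining
Otto Reznikoff criterion" (6 docs:
book:bakry2013 pp 560/461, book:guionnet2009 pp 52–58, GAFA seminar volumes); lit search "Otto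
Reznikoff logarithmic Sobolev" --source all
(local: paper:doi-10-1016-j-jfa-2006-10-002 = OR07, arXiv:1309.0862 Menz, arXiv:1402.5160,
doi-10-1007-s00220-011-1326-6; remote zbMATH/Crossref:
OR07 JFA 243, GOVW doi:10.1214/07-aihp200, Funaki 2011); lit search "Shen Zhu Zhu stochastic lattice
Yang-Mills log-Sobolev" (arXiv:2204.12737,
arXiv:2401.13299); lit search --hybrid "Bakry Emery lattice Yang-Mills Langevin log-Sobolev Shen
Zhu" (montvay1994, friz2019); lit galaxy
search "Otto-Reznikoff|two-scale criterion|two scale logarithmic Sobolev" --star all (4 pdf hits: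
Menz EJP 19 (2014) no.107 = galaxy:pdf:6463678421483061160,
Kwon–Menz arXiv:1807.04333, Marton 0907.4491; panama/crabby 0); lit galaxy search
"Bauerschmidt|Polchinski equation|log-Sobolev inequality
for the continuum" --star pdf (8 hits, none on gauge theories); lit galaxy search
"Nielsen-Olesen|unstable mode|Savvidy" --star all (24 rows,
none mathematical); ledger negatives --problem QuantumFields (no refuted statement on level-j window
entropies or conditioned tails).
Nearest prior art found: arXiv:2204.12737 (Shen–Zhu–Zhu: Bakry–Émery ⇒ LSI + mass gap for lattice YM
at STRONG coupling β < c_d N, one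
scale, full measure); doi:10.1214/07-aihp200 + paper:doi-10-1016-j-jfa-2006-10-002 (two-s  [refs: 10.1214/07-aihp200, 1309.0862, 1402.5160, 2204.12737, 2401.13299, 1807.04333, book:bakry2013, book:guionnet2009, paper:doi-10-1016-j-jfa-2006-10-002, doi-10-1007-s00220-011-1326-6, doi:10.1214/07-aihp200]

Barriers (technique_class: log-sobolev, multiscale-analysis, renormalisation-group): - technique_class: log-sobolev, multiscale-analysis, renormalisation-group
- Literature.Barriers.QuantumFields.UVStabilityNonUniqueness: inside its SUBJECT (K-uniform =
UV-stability-type control of block-averaged fields) but the barrier does not quantify over this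
crux: it says stability bounds alone give only subsequential limits — uniqueness on the torus is
carried by the parent's tilt-comparison residuals (MinimiserStabilityRegPr,
FluctuationComparisonRegPrIntL), not by WindowHerbstL; the line claims no continuum limit, only the
history tail of rung R3.
- Literature.Barriers.QuantumFields.StochasticQuantisationCriticality: outside — no singular-SPDE
solution theory is used (the LSI is a static functional inequality for the lattice law at fixed K, d
= 3 < 4); the Langevin dynamic appears nowhere in the crux.
- Literature.Barriers.QuantumFields.NonabelianCoulombPhaseD5 (token match of the tribunal CLI):
outside — the barrier kills dimension-blind confinement/clustering technique classes; this crux is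
an ultraviolet statement whose proof plan uses d = 3 power counting explicitly (one- and two-loop
self-energies Ward-cancelled, three-loop on convergent) and says nothing about confinement or d ≥ 4.
- Literature.Barriers.QuantumFields.PerturbativeInvisibility: outside — perturbation theory enters
only the UV stiffness of soft modes (asymptotic freedom's sign), never a mass; rung R3 is the torus
continuum statement, not the gap.
- UV-stability wall (critic #97: «the only cut-off-

sub-problem: YangMills · status: draft · opened planner-ym-r3-idea-2-g5-0 2026-08-28T14:40:09Z · rev 4 · ledger route-QuantumFields-MultiscaleHerbst
GENERATED by the gate from the ledger (D-0016/17). Provers cite these decls: `theorem foo : Summit.QuantumFields.YangMills.Theses.MultiscaleHerbst.<Decl> := …` in Summits/QuantumFields/YangMills/Theorems/<Name>.lean.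
-/

namespace Summit.QuantumFields.YangMills.Theses.MultiscaleHerbst

open scoped BigOperators Topology Manifold Classical MeasureTheory ProbabilityTheory Matrix InnerProductSpace ComplexConjugate ContinuousMap
open Filter Set Function TopologicalSpace MeasureTheory

attribute [summit_statement] _root_.YangMills
attribute [summit_statement] _root_.Literature.MathematicalPhysics.QuantumFieldTheory.Balaban1983to89.T3YM3TorusStatement.YM3TorusSU2

/-- item stmt-QuantumFields-28309 · crux · rank 2 · open · by planner
why it might fail: σ must be K,j-uniform on the Chernoff range: beyond s ≈ K/2 only the Ward-dressed stiffness ⟨Hess⟩ − Cov is positive, known only perturbatively (Bałaban UV3 (70)–(71) p.273); JOB B: the bare stiffness changes sign there; W is a sublevel set of non-convex functions (leak at ∂W).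
sources: paper:doi-10-1016-j-jfa-2006-10-002, doi:10.1214/07-aihp200, book:bakry2013-analysis-geometry-markov-diffusion-operators, arXiv:1907.12308, arXiv:2202.02295, arXiv:2204.12737
[crux] CAPPED WINDOW HERBST BOUND — the weakest-sufficient form of WindowHerbstL (amendment after
critic verdict #112, prices 2–3): same window W ⊇ {∀ i < j, PlaqSmall θBal(K−i) (Ū^i)} ∩ {PlaqSmall
θBal(K−j−2) (Ū^(j+2))}, same centring clause ∫_W f dGibbs_K ≤ (p(g_(K−j))/4)·Gibbs_K(W), and the
entropy clause ∫_W e^(tf)·tf − (∫_W e^(tf))·log((∫_W e^(tf))/Gibbs_K(W)) ≤ (σ²t²/2)·∫_W e^(tf) ONLY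
for 0 ≤ t ≤ p(g_(K−j)) (the Chernoff range: t* = min(p, 3p/(4σ²))), f =
dist1(Ū^j(∂a))/√(γL^(−(K−j))), p = B10.pFun b₀ p₀, σ uniform in (K, j, a). BASELINE (what is free,
critic #112): for ANY bounded f and ANY law Ent(e^(tf)) ≤ (osc f)²t²/8·∫e^(tf); on the conditioning
event f ≤ 151L^(5/2)·p(g_(K−j+1)) deterministically (level j−1 is constrained; one-step transport,
HistoryTailBoundedHeight), so the free constant is σ_free ≈ 75L^(5/2)·p and Chernoff with it gives
exp(−O(L^(−5))): NO decay. CONTENT = «σ = O(1) uniformly», i.e. beat the Hoeffding constant by the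
factor p(g)² — a log-Sobolev-strength statement for one observable under the window-restricted Gibbs
law. Named route to it: two-scale LSI (Otto–Reznikoff JFA 243 (2007) Thm 2 p.128, N-site assembly
Thm 1 p.123; Grunewald–Otto–Villani–We -/
@[route_item "route-QuantumFields-MultiscaleHerbst", crux]
def WindowHerbstCapL : Prop :=
  open Literature.MathematicalPhysics.QuantumFieldTheory.Balaban1983to89 Literature.MathematicalPhysics.QuantumFieldTheory.Balaban1983to89.T3ContinuumYM3Torus in ∀ (L : ℕ), ∃ bmin : ℝ, ∀ (b₀ p₀ : ℝ), bmin ≤ b₀ → 0 < b₀ → 2 < p₀ → ∃ γ₁ : ℝ, 0 < γ₁ ∧ γ₁ ≤ 1 ∧ ∀ (F : T3Family) (γ : ℝ), F.L = L → 0 < γ → γ ≤ γ₁ → ∃ σ : ℝ, 0 < σ ∧ ∀ (K j : ℕ), 1 ≤ j → j + 2 ≤ K → ∀ (a : Plaq (F.P K) j), ∃ W, MeasurableSet W ∧ ({U | ∀ i, i < j → PlaqSmall (T3UnitScaleTilt.θBal F.L γ b₀ p₀ (K - i)) (Averaging.iter (fun i' => BlockAveraging.blockAvg (P := F.P K) (j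 := i') T3UnitLawDensityEML.ℰp) i U)} ∩ {U | PlaqSmall (T3UnitScaleTilt.θBal F.L γ b₀ p₀ (K - (j + 2))) (Averaging.iter (fun i' => BlockAveraging.blockAvg (P := F.P K) (j := i') T3UnitLawDensityEML.ℰp) (j + 2) U)}) ⊆ W ∧ (∫ U in W, GaugeGroup.dist1 (GaugeField.plaqHol (Averaging.iter (fun i' => BlockAveraging.blockAvg (P := F.P K) (j := i') T3UnitLawDensityEML.ℰp) j U) a) / Real.sqrt (γ * ((F.L : ℝ)⁻¹) ^ (K - j)) ∂(T3UnitScaleTilt.gibbsK F T3UnitLawDensityEML.ℰp γ K) ≤ B10.pFun b₀ p₀ (Real.sqrt (γ * ((F.L : ℝ)⁻¹) ^ (K - j))) / 4 * (T3UnitScaleTilt.gibbsK F T3UnitLawDensityEML.ℰp γ K).real W) ∧ ∀ (t : ℝ), 0 ≤ t → t ≤ B10.pFun b₀ p₀ (Real.sqrt (γ * ((F.L : ℝ)⁻¹) ^ (K - j))) → (∫ U in W, Real.exp (t * (GaugeGroup.dist1 (GaugeField.plaqHol (Averaging.iter (fun i' => BlockAveraging.blockAvg (P := F.P K) (j :=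 i') T3UnitLawDensityEML.ℰp) j U) a) / Real.sqrt (γ * ((F.L : ℝ)⁻¹) ^ (K - j)))) * (t * (GaugeGroup.dist1 (GaugeField.plaqHol (Averaging.iter (fun i' => BlockAveraging.blockAvg (P := F.P K) (j := i') T3UnitLawDensityEML.ℰp) j U) a) / Real.sqrt (γ * ((F.L : ℝ)⁻¹) ^ (K - j)))) ∂(T3UnitScaleTilt.gibbsK F T3UnitLawDensityEML.ℰp γ K)) - (∫ U in W, Real.exp (t * (GaugeGroup.dist1 (GaugeField.plaqHol (Averaging.iter (fun i' => BlockAveraging.blockAvg (P := F.P K) (j := i') T3UnitLawDensityEML.ℰp) j U) a) / Real.sqrt (γ * ((F.L : ℝ)⁻¹) ^ (K - j)))) ∂(T3UnitScaleTilt.gibbsK F T3UnitLawDensityEML.ℰp γ K)) * Real.log ((∫ U in W, Real.exp (t * (GaugeGroup.dist1 (GaugeField.plaqHol (Averaging.iter (fun i' => BlockAveraging.blockAvg (P := F.P K) (j := i') T3UnitLawDensityEML.ℰp) j U) a) / Real.sqrt (γ * ((F.L : ℝ)⁻¹) ^ (K - j)))) ∂(T3UnitScaleTilt.gibbsK F T3UnitLawDensityEML.ℰp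 γ K)) / (T3UnitScaleTilt.gibbsK F T3UnitLawDensityEML.ℰp γ K).real W) ≤ σ ^ 2 * t ^ 2 / 2 * ∫ U in W, Real.exp (t * (GaugeGroup.dist1 (GaugeField.plaqHol (Averaging.iter (fun i' => BlockAveraging.blockAvg (P := F.P K) (j := i') T3UnitLawDensityEML.ℰp) j U) a) / Real.sqrt (γ * ((F.L : ℝ)⁻¹) ^ (K - j)))) ∂(T3UnitScaleTilt.gibbsK F T3UnitLawDensityEML.ℰp γ K)

/-- item stmt-QuantumFields-25568 · crux · rank 3 · open · by planner
why it might fail: Organ-class residual: conditioner chains with inflated thresholds fail marginally (threshold growth L³/2 per two levels is matched one-for-one by the deterministic transport loss of the window), so no bootstrap from WindowHerbstL is offered.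
sources: Balaban1985UV3, Balaban1989LargeFieldII
[crux] TOWER TAIL (the isolated residual): the same bound for the complementary conditioner status —
Gibbs_K( {θBal(K−j) ≤ dist1(Ū^j(∂a))} ∩ {∀ i < j, PlaqSmall θBal(K−i) (Ū^i)} ∩ {¬ PlaqSmall
θBal(K−j−2) (Ū^(j+2))} ) ≤ C·β_(K−j)^A·exp(−c·p(g_(K−j))²), same quantifier shape. A sub-event of
the plain per-plaquette tail, so implied by Bałaban's (71) read through the parent's lane; the
line's bet is that iterating the lever upward (conditioner large ⇒ a coarser two-sided target,
worst-case extrapolation over the unconditioned window) closes all towers shorter than (K−j)/8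
levels and that longer towers are summably rare. [difficulty: XL] -/
@[route_item "route-QuantumFields-MultiscaleHerbst", crux]
def TowerTailL : Prop :=
  open Literature.MathematicalPhysics.QuantumFieldTheory.Balaban1983to89 Literature.MathematicalPhysics.QuantumFieldTheory.Balaban1983to89.T3ContinuumYM3Torus in ∀ (L : ℕ), ∃ bmin : ℝ, ∀ (b₀ p₀ : ℝ), bmin ≤ b₀ → 0 < b₀ → 2 < p₀ → ∃ γ₁ : ℝ, 0 < γ₁ ∧ γ₁ ≤ 1 ∧ ∀ (F : T3Family) (γ : ℝ), F.L = L → 0 < γ → γ ≤ γ₁ → ∃ (C : ℝ) (A : ℕ) (c : ℝ), 0 ≤ C ∧ 0 < c ∧ ∀ (K j : ℕ), 1 ≤ j → j + 2 ≤ K → ∀ (a : Plaq (F.P K) j), (T3UnitScaleTilt.gibbsK F T3UnitLawDensityEML.ℰp γ K).real ({U | T3UnitScaleTilt.θBal F.L γ b₀ p₀ (K - j) ≤ GaugeGroup.dist1 (GaugeField.plaqHol (Averaging.iter (fun i' => BlockAveraging.blockAvg (P := F.P K) (j := i') T3UnitLawDensityEML.ℰp) j U) a)} ∩ {U | ∀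 i, i < j → PlaqSmall (T3UnitScaleTilt.θBal F.L γ b₀ p₀ (K - i)) (Averaging.iter (fun i' => BlockAveraging.blockAvg (P := F.P K) (j := i') T3UnitLawDensityEML.ℰp) i U)} ∩ {U | ¬ PlaqSmall (T3UnitScaleTilt.θBal F.L γ b₀ p₀ (K - (j + 2))) (Averaging.iter (fun i' => BlockAveraging.blockAvg (P := F.P K) (j := i') T3UnitLawDensityEML.ℰp) (j + 2) U)}) ≤ C * (F.scheme T3UnitLawDensityEML.ℰp γ).β (K - j) ^ A * Real.exp (-(c * B10.pFun b₀ p₀ (Real.sqrt (γ * ((F.L : ℝ)⁻¹) ^ (K - j))) ^ 2))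

/-- item stmt-QuantumFields-20520 · crux · rank 4 · open · by operator
why it might fail: Cross-cut-off content UNPRINTED for non-abelian d=3: the King-slack two-run row at every co-height must come from the (α) record; excision removes only the window's EDGE clause.
sources: Balaban1985UV3, King1986, Balaban1988Convergent
[crux] K1b-INT (E-INT interior excision of FluctuationComparisonRegPrL, OWNER RULING g22-№3 §B +
ADDENDUM 1; card C8 `edge-band-to-the-tail`): for every L there are an EXCISION RATIO 0 < c ≤ 1 and
THRESHOLDS (b₁, p₁) such that for every profile (b₀, p₀) with b₁ ≤ b₀, p₁ ≤ p₀, 0 < b₀, 2 < p₀ there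
is ε₁ > 0 such that for every 0 < ε₀ ≤ ε₁ there is m₀ such that for every m ≥ m₀ there is a
volume-uniform γ₁ > 0 such that for every T3Family F with F.L = L and 0 < γ ≤ γ₁,
`T3InteriorExcision.FluctuationComparisonRegPrIntAt F γ b₀ p₀ m c ε₀`: a.e. on the SHRUNK window
`PlaqSmall (θBal L γ (c·b₀) p₀ (K/m))` both restricted height densities of runs K and K+1 on the
histGood events at the ORIGINAL profile (b₀, p₀) are positive and log ρ + β·minActionRegPr of the
two runs agree modulo constants κ_K up to summable r_K (same body as FluctuationComparisonRegPrAt;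
only the a.e. guard is the c-window). FORMALLY WEAKER than FluctuationComparisonRegPrL (c = 1;
window monotone in b₀: `θBal_mono_b`), NO edge clause (the band {θ(c·b₀)-large, θ(b₀)-small} is
charged to HistoryTailL, whose profile floor absorbs the rescaling:
`T3InteriorExcision.unitTiltTail_of_interior`), and on the c-window print's χ -/
@[route_item "route-QuantumFields-MultiscaleHerbst", crux]
def FluctuationComparisonRegPrIntL : Prop :=
  open Literature.MathematicalPhysics.QuantumFieldTheory.Balaban1983to89 Literature.MathematicalPhysics.QuantumFieldTheory.Balaban1983to89.T3ContinuumYM3Torus in ∀ (L : ℕ), ∃ (c b₁ p₁ : ℝ), 0 < c ∧ c ≤ 1 ∧ ∀ (b₀ p₀ : ℝ), b₁ ≤ b₀ → p₁ ≤ p₀ → 0 < b₀ → 2 < p₀ → ∃ ε₁ : ℝ, 0 < ε₁ ∧ ∀ (ε₀ : ℝ), 0 < ε₀ → ε₀ ≤ ε₁ → ∃ m₀ : ℕ, ∀ (m : ℕ), m₀ ≤ m → ∃ γ₁ : ℝ, 0 < γ₁ ∧ ∀ (F : T3Family) (γ : ℝ), F.L = L → 0 < γ → γ ≤ γ₁ →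 T3InteriorExcision.FluctuationComparisonRegPrIntAt F γ b₀ p₀ m c ε₀

/-- item stmt-QuantumFields-19200 · crux · rank 5 · open · by operator
why it might fail: Printed only as Bałaban's variational-problem stability for small data; the L-uniform quadratic remainder at every co-height is the unprinted part.
sources: Balaban1985Variational, Balaban1985UV3
[crux] K1aR-pr (E-min at the minimum over PRINT'S regular space (6) of Balaban1985Variational IN
FULL — both clauses of (2): small plaquette variables AND small covariant divergence
Balaban1985RegularSpaces (1.9); replaces MinimiserStability stmt-QuantumFields-19822; supersedes
children-v2's plaquette-only MinimiserStabilityReg, which needed the unprinted gap G-K1aR-1 on top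
of [7] Thm 1) — for every block size L there is ε₁(L) > 0 (the uniqueness radius a₀ of
Balaban1985Variational Thm 1, «depends on d and L only») such that for every 0 < ε₀ ≤ ε₁, all
sufficiently large m ≥ m₀(L, ε₀), every profile (b₀, p₀) and all 0 < γ ≤ γ₁(L, ε₀, m, b₀, p₀), every
T3Family F with F.L = L: `MinimiserStabilityRegPrAt F γ b₀ p₀ m ε₀` (tree module
`T3PrintedRegularMinimiser` = `BgStabilityAt` at the printed backgrounds `bgRegPr`/`bgRegPr'`) —
summable r_K ≥ 0 and constants κ_K with, for every K and EVERY θBal(⌊K/m⌋)-small field V on the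
comparison lattice, |β_{K+1}·minActionRegPr_{K+1}(V) − β_K·minActionRegPr_K(V) − κ_K| ≤ r_K (κ
idle), where minActionRegPr_K(V) = inf of the Wilson action over run K's fibre of V ∩ {|U(∂p) − 1| <
ε₀L^{-2(K−⌊K/m⌋)} ∀p} ∩ {‖(D^{1*}_U ∂U)(b)‖ < ε₀L^{-3(K−⌊K/m⌋)} ∀b} (d -/
@[route_item "route-QuantumFields-MultiscaleHerbst", crux]
def MinimiserStabilityRegPr : Prop :=
  open Literature.MathematicalPhysics.QuantumFieldTheory.Balaban1983to89 Literature.MathematicalPhysics.QuantumFieldTheory.Balaban1983to89.T3ContinuumYM3Torus in ∀ (L : ℕ), ∃ ε₁ : ℝ, 0 < ε₁ ∧ ∀ (ε₀ : ℝ), 0 < ε₀ → ε₀ ≤ ε₁ → ∃ m₀ : ℕ, ∀ (m : ℕ), m₀ ≤ m → ∀ (b₀ p₀ : ℝ), 0 < b₀ → 2 < p₀ → ∃ γ₁ : ℝ, 0 < γ₁ ∧ ∀ (F : T3Family) (γ : ℝ), F.L = L → 0 < γ → γ ≤ γ₁ → T3PrintedRegularMinimiser.MinimiserStabilityRegPrAt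 F γ b₀ p₀ m ε₀

/-- item stmt-QuantumFields-28165 · aside · rank 2 · open · by planner
why it might fail: σ must be K,j-uniform for ALL t ≥ 0: (i) beyond s ≈ K/2 only the Ward-dressed stiffness is positive and no non-perturbative proof of ⟨Hess⟩ − Cov ≥ ½ρ_s exists; (ii) W is a sublevel set of non-convex plaquette functions — LSI for the restricted law may leak at ∂W (W ⊇ window is free to convexify).
sources: doi:10.1214/07-aihp200, paper:doi-10-1016-j-jfa-2006-10-002, arXiv:1309.0862, arXiv:2204.12737, Balaban1985UV3, Balaban1984PropagatorsI
[crux] WINDOW HERBST BOUND — ∀ L ∃ bmin ∀ b₀ ≥ bmin (0 < b₀), p₀ > 2 ∃ 0 < γ₁ ≤ 1 ∀ F (F.L = L), 0 <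
γ ≤ γ₁ ∃ σ > 0 ∀ K, 1 ≤ j, j+2 ≤ K, ∀ level-j plaquette a ∃ measurable W ⊇ {∀ i < j, PlaqSmall
θBal(K−i) (Ū^i)} ∩ {PlaqSmall θBal(K−j−2) (Ū^(j+2))}: (centring) ∫_W f dGibbs_K ≤
(p(g_(K−j))/4)·Gibbs_K(W) and (entropy) ∀ t ≥ 0, ∫_W e^(tf)·tf − (∫_W e^(tf))·log((∫_W
e^(tf))/Gibbs_K(W)) ≤ (σ²t²/2)·∫_W e^(tf), with f = dist1(Ū^j(∂a))/√(γL^(−(K−j))) and p = B10.pFun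
b₀ p₀ (junk-safe: Gibbs_K(W) = 0 makes both sides 0; f is bounded so every integral exists).
[difficulty: XL] -/
@[route_item "route-QuantumFields-MultiscaleHerbst"]
def WindowHerbstL : Prop :=
  open Literature.MathematicalPhysics.QuantumFieldTheory.Balaban1983to89 Literature.MathematicalPhysics.QuantumFieldTheory.Balaban1983to89.T3ContinuumYM3Torus in ∀ (L : ℕ), ∃ bmin : ℝ, ∀ (b₀ p₀ : ℝ), bmin ≤ b₀ → 0 < b₀ → 2 < p₀ → ∃ γ₁ : ℝ, 0 < γ₁ ∧ γ₁ ≤ 1 ∧ ∀ (F : T3Family) (γ : ℝ), F.L = L → 0 < γ → γ ≤ γ₁ → ∃ σ : ℝ, 0 < σ ∧ ∀ (K j : ℕ), 1 ≤ j → j + 2 ≤ K → ∀ (a : Plaq (F.P K) j), ∃ W, MeasurableSet W ∧ ({U | ∀ i, i < j → PlaqSmall (T3UnitScaleTilt.θBal F.L γ b₀ p₀ (K - i)) (Averaging.iter (fun i' => BlockAveraging.blockAvg (P := F.P K) (j := i') T3UnitLawDensityEML.ℰp) i U)} ∩ {U | PlaqSmall (T3UnitScaleTilt.θBal F.L γ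 b₀ p₀ (K - (j + 2))) (Averaging.iter (fun i' => BlockAveraging.blockAvg (P := F.P K) (j := i') T3UnitLawDensityEML.ℰp) (j + 2) U)}) ⊆ W ∧ (∫ U in W, GaugeGroup.dist1 (GaugeField.plaqHol (Averaging.iter (fun i' => BlockAveraging.blockAvg (P := F.P K) (j := i') T3UnitLawDensityEML.ℰp) j U) a) / Real.sqrt (γ * ((F.L : ℝ)⁻¹) ^ (K - j)) ∂(T3UnitScaleTilt.gibbsK F T3UnitLawDensityEML.ℰp γ K) ≤ B10.pFun b₀ p₀ (Real.sqrt (γ * ((F.L : ℝ)⁻¹) ^ (K - j))) / 4 * (T3UnitScaleTilt.gibbsK F T3UnitLawDensityEML.ℰp γ K).real W) ∧ ∀ (t : ℝ), 0 ≤ t → (∫ U in W, Real.exp (t * (GaugeGroup.dist1 (GaugeField.plaqHol (Averaging.iter (fun i' => BlockAveraging.blockAvg (P := F.P K) (j := i') T3UnitLawDensityEML.ℰp) j U) a) / Real.sqrt (γ * ((F.L : ℝ)⁻¹) ^ (K - j)))) * (t * (GaugeGroup.dist1 (GaugeField.plaqHol (Averaging.iter (fun i' => BlockAveraging.blockAvg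 (P := F.P K) (j := i') T3UnitLawDensityEML.ℰp) j U) a) / Real.sqrt (γ * ((F.L : ℝ)⁻¹) ^ (K - j)))) ∂(T3UnitScaleTilt.gibbsK F T3UnitLawDensityEML.ℰp γ K)) - (∫ U in W, Real.exp (t * (GaugeGroup.dist1 (GaugeField.plaqHol (Averaging.iter (fun i' => BlockAveraging.blockAvg (P := F.P K) (j := i') T3UnitLawDensityEML.ℰp) j U) a) / Real.sqrt (γ * ((F.L : ℝ)⁻¹) ^ (K - j)))) ∂(T3UnitScaleTilt.gibbsK F T3UnitLawDensityEML.ℰp γ K)) * Real.log ((∫ U in W, Real.exp (t * (GaugeGroup.dist1 (GaugeField.plaqHol (Averaging.iter (fun i' => BlockAveraging.blockAvg (P := F.P K) (j := i') T3UnitLawDensityEML.ℰp) j U) a) / Real.sqrt (γ * ((F.L : ℝ)⁻¹) ^ (K - j)))) ∂(T3UnitScaleTilt.gibbsK F T3UnitLawDensityEML.ℰp γ K)) / (T3UnitScaleTilt.gibbsK F T3UnitLawDensityEML.ℰp γ K).real W) ≤ σ ^ 2 * t ^ 2 / 2 * ∫ U in W, Real.exp (t * (GaugeGroup.dist1 (GaugeField.plaqHol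 (Averaging.iter (fun i' => BlockAveraging.blockAvg (P := F.P K) (j := i') T3UnitLawDensityEML.ℰp) j U) a) / Real.sqrt (γ * ((F.L : ℝ)⁻¹) ^ (K - j)))) ∂(T3UnitScaleTilt.gibbsK F T3UnitLawDensityEML.ℰp γ K)

/-- item stmt-QuantumFields-28166 · support · rank 9 · closed · proved by Summit.QuantumFields.YangMills.Theorems.MultiscaleHerbstTwoSidedOfWindowHerbst.stub_twoSidedOfWindowHerbst (prover) · by planner
sources: book:bakry2013-analysis-geometry-markov-diffusion-operators, arXiv:2204.12737
[support] HERBST + CHERNOFF (provable now, M): WindowHerbstL → FibreConvexityTail.TwoSidedTailL.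
Integrate the entropy bound (d/dt of t⁻¹·log ∫_W e^(tf) ≤ σ²/2, start value E_W f ≤ p/4) to ∫_W
e^(tf) ≤ Gibbs_K(W)·exp(tp/4 + σ²t²/2); Markov at t = 3p/(4σ²) on W ∩ {p ≤ f} ⊇ the two-sided event
(θBal(K−j) = g·p(g), `T3UnitScaleTilt.θBal`) gives C = 1, A = 0, c = 9/(32σ²); bmin, γ₁ pass
through. Pattern: the landed `FibreConvexityTail.stub_chernoffOnEvent` /
`measureReal_le_of_mgf_restrict_le`. [difficulty: provable-now] -/
@[route_item "route-QuantumFields-MultiscaleHerbst"]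
def TwoSidedOfWindowHerbst : Prop :=
  WindowHerbstL → Summit.QuantumFields.YangMills.Theses.FibreConvexityTail.TwoSidedTailL

-- `TwoSidedOfWindowHerbst` holds: proved by `Summit.QuantumFields.YangMills.Theorems.MultiscaleHerbstTwoSidedOfWindowHerbst.stub_twoSidedOfWindowHerbst` (its module imports this route file, so no `_holds` link can be stated here).

/-- item stmt-QuantumFields-28310 · support · rank 9 · closed · proved by Summit.QuantumFields.YangMills.Theorems.MultiscaleHerbstCap.twoSidedOfWindowHerbstCap_proof (prover) · by planner
[support] HERBST ON [0, p] + CHERNOFF (provable now, S): WindowHerbstCapL →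
FibreConvexityTail.TwoSidedTailL. Adapt the landed p643113
`Theorems/MultiscaleHerbstTwoSidedOfWindowHerbst.lean`: `herbst_mgf_le` with the entropy hypothesis
on [0, T] only (the argument φ′ ≤ 0 for φ(t) = t⁻¹·log(∫_W e^(tf)/Gibbs_K(W)) − σ²t/2 is local in
t), T = p(g_(K−j)); then Chernoff on W ∩ {p ≤ f} ⊇ twoSidedEvent at t = min(p, 3p/(4σ²))
(equivalently replace σ by max σ 1 and take t = 3p/(4σ²) ≤ p): C = 1, A = 0, c = min(1/4, 9/(32σ²));
bmin, γ₁ ≤ 1 pass through. In-tree pieces: `Literature.Probability.Moments.HerbstArgument`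
(cgf_le_of_entropy_le, [BakryGentilLedoux2014 Prop 5.4.1]),
`FibreConvexityTail.stub_chernoffOnEvent` pattern (`measureReal_le_of_mgf_restrict_le`). -/
@[route_item "route-QuantumFields-MultiscaleHerbst", crux]
def TwoSidedOfWindowHerbstCap : Prop :=
  WindowHerbstCapL → Summit.QuantumFields.YangMills.Theses.FibreConvexityTail.TwoSidedTailL

-- `TwoSidedOfWindowHerbstCap` holds: proved by `Summit.QuantumFields.YangMills.Theorems.MultiscaleHerbstCap.twoSidedOfWindowHerbstCap_proof` (its module imports this route file, so no `_holds` link can be stated here).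

/-- item stmt-QuantumFields-28167 · assembly · rank 1 · closed · proved by Summit.QuantumFields.YangMills.Theorems.multiscaleHerbst_assembly (prover) · by planner
sources: King1986, Balaban1985UV3
[assembly] MinimiserStabilityRegPr → FluctuationComparisonRegPrIntL → WindowHerbstL → TowerTailL →
TwoSidedOfWindowHerbst → the leaf YM3TorusSU2 (rung R3; not the summit Statement). -/
@[route_item "route-QuantumFields-MultiscaleHerbst"]
def Assembly : Prop :=
  MinimiserStabilityRegPr → FluctuationComparisonRegPrIntL → WindowHerbstL → TowerTailL → TwoSidedOfWindowHerbst → Literature.MathematicalPhysics.QuantumFieldTheory.Balaban1983to89.T3YM3TorusStatement.YM3TorusSU2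

-- `Assembly` holds: proved by `Summit.QuantumFields.YangMills.Theorems.multiscaleHerbst_assembly` (its module imports this route file, so no `_holds` link can be stated here).

/-! D-0027 §2.1 — DECIDING THEOREM (planner-authored via `route open/edit --closes-file`; by planner-ym-r3-idea-2-g5-0 2026-08-28T15:27:19Z):
its hypotheses are this route's items and its conclusion the registered leaf `Literature.MathematicalPhysics.QuantumFieldTheory.Balaban1983to89.T3YM3TorusStatement.YM3TorusSU2` (rung R3, D-0061) (glue_lint), and it elaborates with this file. -/

@[closes "route-QuantumFields-MultiscaleHerbst"] theorem closes (h200 : MinimiserStabilityRegPr) (h201 : FluctuationComparisonRegPrIntL) (hXc : WindowHerbstCapL) (hT : TowerTailL) (hGc : TwoSidedOfWindowHerbstCap) : Literature.MathematicalPhysics.QuantumFieldTheory.Balaban1983to89.T3YM3TorusStatement.YM3TorusSU2 := Summit.QuantumFields.YangMills.Theses.UnitScaleTilt.closes h200 h201 (Summit.QuantumFields.YangMills.Theorems.fibreConvexityTail_historyTailOfTwoSided_proof (hGc hXc) hT)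

end Summit.QuantumFields.YangMills.Theses.MultiscaleHerbst
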